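import Literature.AlgebraicGeometry.ShimuraVarieties.UnitaryShimuraCurveRecord
import Literature.AlgebraicGeometry.ModuliOfAbelianVarieties.SiegelShimuraSetUniformisedPieces
import HarnessLib

/-!
# The Siegel point map of the unitary Shimura curve along a Hodge-embedding datum on the negative cone

Topic `AlgebraicGeometry/ShimuraVarieties`; namespace `Literature.AlgebraicGeometry.ShimuraVarieties.UnitaryCurve`.
THEOREMS ONLY (no `def`, no named fact, no instance, no `sorry`).  Cell `hodgecm-mathlib`, crux HLiu418
(stmt-HodgeConjecture-24832), sub-line P6a, E-line `F0_P6a_PELWitnessE` (GEN heir A-p18 (g31), cand v2 `AuxChartGS` §2), organ **E3**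
(LEAD F0P6-plan (g2) 2026-09-01T21:45:42Z): the point map `Sh_K(U(J⋆), 𝔻)(ℂ) → 𝓜(ℂ)` of [Deligne1979ShimuraVarieties] Prop. 2.3.10 ∕
[Milne2005ShimuraVarieties] Lemma 5.13, Thm. 5.16, for the rank-2 cone-coordinate Shimura set ★ `ShimuraSetGS` of ★ `UnitaryShimuraCurveRecord`,
PARAMETRIC in the whole Hodge-embedding datum — the rank-2 twin of the cell's rank-3 ★ `UnitaryAuxiliarySiegelPointWellDefined` (leaf α) and
★ `UnitaryAuxiliarySiegelSliceLift` (leaf β), with the Siegel target read through the ABSTRACT uniformised pieces of the (U) fact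
(★ `SiegelShimuraSetUniformisedPieces`, clauses (U1)+(U2+) of ★ `siegelModuli_complexUniformisation`).

THE DATUM (hypotheses, instantiated by E2 `UnitaryCurveAuxiliaryComplexStructure∕PeriodMap` and E1 ★ `UnitaryCurveAuxiliarySymplecticAdelicV`):
* a family of symplectic complex structures on the negative cone of `J⋆^τ`, `J : (Fin 2 → ℂ) → M_{2g}(ℝ)`, valued in the Siegel double
  space `X = S^±` (`hJ`), in the half `X⁻` (`hJneg`), constant on punctured lines (`hJsmul`);
* a group map `b : U(J⋆)(𝔸_{L⁺,f}) → GSp_δ(𝔸_f)` with a rational companion `bq : U(J⋆)(L⁺) → GSp_δ(ℚ)` (`hb`, the square ★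
  `gspRationalToFinAdelic_auxToGspRatV`) intertwining the actions on the cone and on `X` (`hJrat`: `J(γ^τ v) = bq(γ) J(v) bq(γ)⁻¹`);
* a source level `K ≤ b⁻¹(K_δ(N))` (`hle`);
* (for the moduli reading) E2's PERIOD CHART in abstract-`γ` currency (`hZ`, ★ `hasHolomorphicSiegelLift_of_negConeChart` :182 token-for-token
  with the ball replaced by the negative cone): for every real similitude `γ` moving the whole family into `X⁺`, a matrix lift `Z`, entrywise
  holomorphic on the negative cone, `𝔥_g`-valued, with `γ J(v) γ⁻¹ = J(Z(v))`;
* the Siegel side as ABSTRACT UNIFORMISED PIECES indexed by `(ℤ/N)ˣ`: a `ℂ`-scheme `Mc` exhibited as the coproduct of pieces `Sc c` (a colimit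
  cofan `ιc`, clause (U1)) with maps `unif c : 𝔥_g → (Sc c)(ℂ)` onto, whose fibres are the `Γ_δ(N)`-classes (clause (U2+), `hsurj`, `hiff`).

WHAT IS PROVED.
* §1 `siegelShimuraSet_mk_eq_of_gs_mk_eq`, `exists_siegelPointMapGS` — the class map `φ : [v, aK] ↦ [J(v), b(a)·K_δ(N)]` into the Siegel
  Shimura SET `Sh_{K_δ(N)}(GSp_δ, S^±)(ℂ)` is well defined ([Deligne1971TravauxShimura] Prop. 1.15; ★ leaf α verbatim with `γ`-only relation).
* §2 `exists_sliceChart` — SLICE CONSTANCY ([Milne2005ShimuraVarieties] Thm. 5.16 «obvious from (3.14)», ★ leaf β steps (1)–(3)): along the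
  slice `{[v, aK] : v ∈ negCone}` the piece `c_a` and the rational translate `γ_a` (of NEGATIVE multiplier, `X = X⁺ ⊔ X⁻`, `negCone` maps into
  `X⁻`) are constant, so E2's chart for `γ_a⁻¹` gives `Z_a` with `[J(v), b(a)] = [J(Z_a(v)), r_{c_a}]` for all `v`.
* §3 **`exists_moduliPointMapGS`** (THE HEAD consumed by `AuxChartGS`): there are `f : Sh_K(ℂ) → Mc(ℂ)`, `piece`, `Z`, principal
  representatives `u_c`, `rep c = diag(1, u_c·1) ∈ K_δ(1)` with the five (U3) premisses of ★ `siegelModuli_complexUniformisation`, and a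
  bijection `pts : Mc(ℂ) ≃ Sh_{K_δ(N)}(ℂ)` such that `Z a` is entrywise holomorphic and `𝔥_g`-valued on the negative cone,
  `f [v, aK] = (ιc (piece a))(ℂ) (unif (piece a) (Z a v))` (`f_mk`), `pts (f [v, aK]) = [J(v), b(a)]`, `[J(v), b(a)] = [J(Z a v), rep (piece a)]`
  and `pts ((ιc c)(ℂ)(unif c W)) = [J(W), rep c]` — the chart fields `f piece Z Z_hol Z_mem f_mk` BY VALUE, the (U3∃) input of `f_admissible`,
  and the transport of injectivity questions to the Siegel Shimura set (`pts` is a bijection; tower separation is the sister file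
  `UnitaryCurveSiegelPointSeparation`).

Nothing here depends on the rank, on a frame, on a CM type or on a moduli scheme: E2 instantiates `J`, E1∕E2 instantiate `b, bq`, GEN instantiates
`Mc := 𝓜.M ⊗_ℚ ℂ` from ★ `siegelModuli_complexUniformisation_holds`.  HC_CM is proved only modulo the 2 remaining named inputs (hLiu418 24832,
h413 24833) until rung 0 closes; this file discharges neither (count-neutral support of 24832).

## References
* [Deligne1979ShimuraVarieties] P. Deligne, *Variétés de Shimura: interprétation modulaire…* (1979), Prop. 2.3.10, 2.1.2, 1.3.1.
* [Deligne1971TravauxShimura] P. Deligne, *Travaux de Shimura*, Sém. Bourbaki 389 (1971), Prop. 1.15 p. 132, 1.8 p. 129, Exemple 4.16 p. 150.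
* [Milne2005ShimuraVarieties] J. S. Milne, *Introduction to Shimura varieties* (2005), §5 (5.1) p. 56, Lemma 5.13 p. 57, Def. 5.15–Thm. 5.16,
  Thm. 5.17 p. 59, §6 pp. 67–70, Thm. 6.11 p. 74.
* [RapoportSmithlingZhang2020Diagonal] M. Rapoport, B. Smithling, W. Zhang, *Arithmetic diagonal cycles on unitary Shimura varieties* (2020),
  §3.2 and Prop. 3.7 (proof) pp. 11–14 (the auxiliary Siegel embedding of the unitary datum).
-/

set_option autoImplicit false

noncomputable section

open Function Matrix NumberField IsDedekindDomain CategoryTheory CategoryTheory.Limits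
open scoped Matrix ComplexOrder
open Literature.AlgebraicGeometry.Motives (SchemeOver ComplexPoints AlgPoints)
open Literature.NumberTheory.Automorphic (siegelUpperHalfSpace)
open Literature.NumberTheory.Automorphic.UnitaryGroup
open Literature.AlgebraicGeometry.ModuliOfAbelianVarieties
open Literature.AlgebraicGeometry.ModuliOfAbelianVarieties.SiegelModuli (C0 mem_C0_iff jOfSiegel jOfSiegel_mem_C0)

namespace Literature.AlgebraicGeometry.ShimuraVarieties

open UnitaryCanonicalModel

namespace UnitaryCurve

variable {L : Type} [Field L] [NumberField L] [IsCMField L] {Jstar : Matrix (Fin 2) (Fin 2) L} {τ : L →+* ℂ}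
variable {g : ℕ} {δ : Fin g → ℕ} {N : ℕ}
variable (J : (Fin 2 → ℂ) → Matrix (Fin g ⊕ Fin g) (Fin g ⊕ Fin g) ℝ)
  (hJ : ∀ v : Fin 2 → ℂ, v ∈ negCone (Jstar.map τ) → J v ∈ C0pm δ)
  (b : ↥(finAdelic (↥(maximalRealSubfield L)) L (IsCMField.complexConj L) 2 Jstar) →* ↥(gspFinAdelic δ))
  (bq : ↥(rational (↥(maximalRealSubfield L)) L (IsCMField.complexConj L) 2 Jstar) →* ↥(gspRational δ))

/-! ### §1. The class map `[v, aK] ↦ [J(v), b(a)·K_δ(N)]` is well defined ([Deligne 1971] Prop. 1.15; leaf α) -/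

section WellDefined

/-- **The Siegel point `[J(v), b(a)·K_δ(N)]` depends only on the class `[v, aK]`**: if `[v, aK] = [v′, a′K]` in `Sh_K(U(J⋆), 𝔻)(ℂ)`
(`c · γ^τ v′ = v`, `γ a′K = aK` with `γ ∈ U(J⋆)(L⁺)`, `c ∈ ℂˣ`, ★ `ShimuraSetGS.mk_eq_mk_iff`) then `[J(v), b(a)K_δ(N)] = [J(v′), b(a′)K_δ(N)]` in
`Sh_{K_δ(N)}(GSp_δ, S^±)(ℂ)` — the rational element `bq γ ∈ GSp_δ(ℚ)` does it: `J` is constant on punctured lines (`hJsmul`) and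
`U(J⋆)(L⁺)`-equivariant through `bq` (`hJrat`), the square `b(γ_𝔸) = (bq γ)_𝔸` (`hb`) holds, and `b(K) ⊆ K_δ(N)` (`hle`).  Rank-2 twin of ★
`siegelShimuraSet_mk_eq_of_rel` (no torus class: the datum has `γ`-only relations).
[cite: Deligne1971TravauxShimura, Prop. 1.15 p. 132] [cite: Milne2005ShimuraVarieties, Lemma 5.13 p. 57] [cite: Deligne1979ShimuraVarieties, Prop. 2.3.10] -/
theorem siegelShimuraSet_mk_eq_of_gs_mk_eq
    (hJsmul : ∀ c : ℂ, c ≠ 0 → ∀ v : Fin 2 → ℂ, v ∈ negCone (Jstar.map τ) → J (c • v) = J v)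
    (hb : ∀ γ : ↥(rational (↥(maximalRealSubfield L)) L (IsCMField.complexConj L) 2 Jstar),
      b (rationalToFinAdelic (↥(maximalRealSubfield L)) L (IsCMField.complexConj L) 2 Jstar γ) = gspRationalToFinAdelic δ (bq γ))
    (hJrat : ∀ (γ : ↥(rational (↥(maximalRealSubfield L)) L (IsCMField.complexConj L) 2 Jstar)) (v : Fin 2 → ℂ),
      v ∈ negCone (Jstar.map τ) →
        J (((ratToGLℂ L Jstar τ γ : GL (Fin 2) ℂ) : Matrix (Fin 2) (Fin 2) ℂ) *ᵥ v) =
          conjJ ((gspRationalToReal δ (bq γ) : ↥(gspReal δ)) : GL (Fin g ⊕ Fin g) ℝ) (J v))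
    (K : Subgroup ↥(finAdelic (↥(maximalRealSubfield L)) L (IsCMField.complexConj L) 2 Jstar))
    (hle : K ≤ (principalLevelSubgroup δ N).comap b)
    {v v' : Fin 2 → ℂ} {hv : v ∈ negCone (Jstar.map τ)} {hv' : v' ∈ negCone (Jstar.map τ)}
    {a a' : ↥(finAdelic (↥(maximalRealSubfield L)) L (IsCMField.complexConj L) 2 Jstar)}
    (h : ShimuraSetGS.mk L Jstar τ K v hv a = ShimuraSetGS.mk L Jstar τ K v' hv' a') :
    SiegelShimuraSet.mk δ (principalLevelSubgroup δ N) ⟨J v, hJ v hv⟩ (b a) =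
      SiegelShimuraSet.mk δ (principalLevelSubgroup δ N) ⟨J v', hJ v' hv'⟩ (b a') := by
  -- the unitary relation: `c • γ^τ v' = v`, `γ • a'K = aK`
  obtain ⟨γ, c, hc, hcv, hk⟩ := (ShimuraSetGS.mk_eq_mk_iff L Jstar τ K v v' hv hv' a a').1 h
  -- `γ^τ v' = c⁻¹ • v` lies on the negative cone
  have hγv' : ((ratToGLℂ L Jstar τ γ : GL (Fin 2) ℂ) : Matrix (Fin 2) (Fin 2) ℂ) *ᵥ v' = c⁻¹ • v := by
    rw [← hcv, smul_smul, inv_mul_cancel₀ hc, one_smul]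
  have hγv'mem : ((ratToGLℂ L Jstar τ γ : GL (Fin 2) ℂ) : Matrix (Fin 2) (Fin 2) ℂ) *ᵥ v' ∈ negCone (Jstar.map τ) := by
    rw [hγv']
    exact smul_mem_negCone (inv_ne_zero hc) hv
  -- `k := (γ_𝔸 a')⁻¹ a ∈ K`
  have hkK : (rationalToFinAdelic (↥(maximalRealSubfield L)) L (IsCMField.complexConj L) 2 Jstar γ * a')⁻¹ * a ∈ K := by
    rw [MulAction.Quotient.smul_mk, smul_eq_mul, QuotientGroup.eq] at hk
    exact hk
  refine (SiegelShimuraSet.mk_eq_mk_iff δ (principalLevelSubgroup δ N) _ _ _ _).2 ⟨bq γ, ?_, ?_⟩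
  · -- equivariance of the complex structure
    apply Subtype.ext
    rw [coe_conjAct]
    change conjJ _ (J v') = J v
    rw [← hJrat γ v' hv', hγv', hJsmul c⁻¹ (inv_ne_zero hc) v hv]
  · -- the finite-adelic classes: `(bq γ)_𝔸 · b a' = b (γ_𝔸 a')` and `b ((γ_𝔸 a')⁻¹ a) ∈ K_δ(N)`
    rw [← hb, MulAction.Quotient.smul_mk, smul_eq_mul, ← map_mul]
    apply QuotientGroup.eq.2
    rw [← map_inv, ← map_mul]
    exact hle hkK

/-- **The class map `[v, aK] ↦ [J(v), b(a)·K_δ(N)]` exists** (descended form of `siegelShimuraSet_mk_eq_of_gs_mk_eq`: a section of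
`ShimuraSetGS.mk` composed with the Siegel class). [cite: Deligne1971TravauxShimura, Prop. 1.15 p. 132] [cite: Milne2005ShimuraVarieties, Lemma 5.13 p. 57] -/
theorem exists_siegelPointMapGS
    (hJsmul : ∀ c : ℂ, c ≠ 0 → ∀ v : Fin 2 → ℂ, v ∈ negCone (Jstar.map τ) → J (c • v) = J v)
    (hb : ∀ γ : ↥(rational (↥(maximalRealSubfield L)) L (IsCMField.complexConj L) 2 Jstar),
      b (rationalToFinAdelic (↥(maximalRealSubfield L)) L (IsCMField.complexConj L) 2 Jstar γ) = gspRationalToFinAdelic δ (bq γ))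
    (hJrat : ∀ (γ : ↥(rational (↥(maximalRealSubfield L)) L (IsCMField.complexConj L) 2 Jstar)) (v : Fin 2 → ℂ),
      v ∈ negCone (Jstar.map τ) →
        J (((ratToGLℂ L Jstar τ γ : GL (Fin 2) ℂ) : Matrix (Fin 2) (Fin 2) ℂ) *ᵥ v) =
          conjJ ((gspRationalToReal δ (bq γ) : ↥(gspReal δ)) : GL (Fin g ⊕ Fin g) ℝ) (J v))
    (K : Subgroup ↥(finAdelic (↥(maximalRealSubfield L)) L (IsCMField.complexConj L) 2 Jstar))
    (hle : K ≤ (principalLevelSubgroup δ N).comap b) :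
    ∃ φ : ShimuraSetGS L Jstar τ K → SiegelShimuraSet δ (principalLevelSubgroup δ N),
      ∀ (v : Fin 2 → ℂ) (hv : v ∈ negCone (Jstar.map τ)) (a : ↥(finAdelic (↥(maximalRealSubfield L)) L (IsCMField.complexConj L) 2 Jstar)),
        φ (ShimuraSetGS.mk L Jstar τ K v hv a) = SiegelShimuraSet.mk δ (principalLevelSubgroup δ N) ⟨J v, hJ v hv⟩ (b a) := by
  classical
  have hs := ShimuraSetGS.mk_surjective L Jstar τ K
  choose sv shv sa hmk using hs
  refine ⟨fun x => SiegelShimuraSet.mk δ (principalLevelSubgroup δ N) ⟨J (sv x), hJ _ (shv x)⟩ (b (sa x)), fun v hv a => ?_⟩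
  exact siegelShimuraSet_mk_eq_of_gs_mk_eq J hJ b bq hJsmul hb hJrat K hle (hmk (ShimuraSetGS.mk L Jstar τ K v hv a))

end WellDefined

/-! ### §2. Slice constancy: one piece and one rational translate per slice ([Milne ISV] Thm. 5.16; leaf β steps (1)–(3)) -/

section Slice

/-- **THE SLICE CHART.**  Let every Siegel class at level `K_δ(N)` be a moduli class `[J(W), rep c]` (`W ∈ 𝔥_g`; `hrep`, the
pointwise reading of the principal dissection ★ `exists_sigma_equiv_siegelShimuraSet_of_unif`), let the family `J` lie in `X⁻` (`hJneg`) and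
let E2's period chart `hZ` be given.  Then for every adelic `a` there are ONE piece `c` and ONE matrix function `Z_a`, entrywise holomorphic on the
negative cone, with `Z_a(v) ∈ 𝔥_g` and `[J(v), b(a)] = [J(Z_a(v)), rep c]` for ALL `v` on the cone.  Proof (★ `hasHolomorphicSiegelLift_of_negConeChart`
steps (1)–(4) with `Sg.pts` replaced by `hrep`): at a base point `v₀`, `[J(v₀), b a] = [J(W₀), rep c]` gives `γ ∈ GSp_δ(ℚ)` with
`γ J(W₀) γ⁻¹ = J(v₀)`; `γ⁻¹` has NEGATIVE multiplier (`J(v₀) ∈ X⁻`, `J(W₀) ∈ X⁺`, positive multipliers preserve the halves ★ `conjJ_mem_C0_of_pos`,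
★ `neg_not_mem_C0_of_mem_C0`), hence moves the whole family into `X⁺` (★ `neg_conjJ_mem_C0_of_neg`); the chart `Z` of `hZ` for `γ⁻¹` does it
(`[J(v), b a] = [γ J(Z v) γ⁻¹, γ·rep c] = [J(Z v), rep c]`).  On an empty cone the statement is witnessed by `c = 1`, `Z = 0`.
[cite: Milne2005ShimuraVarieties, Thm. 5.16 with Def. 5.15; §6 pp. 67–70; Lemma 5.13 p. 57] [cite: Deligne1979ShimuraVarieties, Prop. 2.3.10] -/
theorem exists_sliceChart (hg : 0 < g) (hδ : ∀ i, 0 < δ i)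
    (hJneg : ∀ v : Fin 2 → ℂ, v ∈ negCone (Jstar.map τ) → -J v ∈ C0 δ)
    (hZ : ∀ γ : GL (Fin g ⊕ Fin g) ℝ, γ ∈ gspReal δ → (∀ v : Fin 2 → ℂ, v ∈ negCone (Jstar.map τ) → conjJ γ (J v) ∈ C0 δ) →
      ∃ Z : (Fin 2 → ℂ) → Matrix (Fin g) (Fin g) ℂ,
        (∀ i j : Fin g, DifferentiableOn ℂ (fun v => Z v i j) (negCone (Jstar.map τ))) ∧
          ∀ v : Fin 2 → ℂ, v ∈ negCone (Jstar.map τ) → Z v ∈ siegelUpperHalfSpace g ∧ conjJ γ (J v) = jOfSiegel δ (Z v))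
    {ι : Type*} (rep : ι → ↥(gspFinAdelic δ)) (c₀ : ι)
    (hrep : ∀ x : SiegelShimuraSet δ (principalLevelSubgroup δ N), ∃ (c : ι) (W : Matrix (Fin g) (Fin g) ℂ) (hW : W ∈ siegelUpperHalfSpace g),
      x = SiegelShimuraSet.mk δ (principalLevelSubgroup δ N) ⟨jOfSiegel δ W, C0_subset_C0pm δ (jOfSiegel_mem_C0 hδ hW)⟩ (rep c))
    (a : ↥(finAdelic (↥(maximalRealSubfield L)) L (IsCMField.complexConj L) 2 Jstar)) :
    ∃ (c : ι) (Z : (Fin 2 → ℂ) → Matrix (Fin g) (Fin g) ℂ),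
      (∀ i j : Fin g, DifferentiableOn ℂ (fun v => Z v i j) (negCone (Jstar.map τ))) ∧
        ∀ (v : Fin 2 → ℂ) (hv : v ∈ negCone (Jstar.map τ)), ∃ hZv : Z v ∈ siegelUpperHalfSpace g,
          SiegelShimuraSet.mk δ (principalLevelSubgroup δ N) ⟨J v, hJ v hv⟩ (b a) =
            SiegelShimuraSet.mk δ (principalLevelSubgroup δ N) ⟨jOfSiegel δ (Z v), C0_subset_C0pm δ (jOfSiegel_mem_C0 hδ hZv)⟩ (rep c) := by
  by_cases hne : (negCone (Jstar.map τ)).Nonempty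
  swap
  · -- empty cone: nothing to chart
    refine ⟨c₀, fun _ => 0, fun i j => ?_, fun v hv => absurd ⟨v, hv⟩ hne⟩
    exact differentiableOn_const (c := (0 : ℂ))
  obtain ⟨v₀, hv₀⟩ := hne
  -- (1) the piece and the rational translate at the base point `v₀`
  obtain ⟨c, W₀, hW₀, hq⟩ := hrep (SiegelShimuraSet.mk δ (principalLevelSubgroup δ N) ⟨J v₀, hJ v₀ hv₀⟩ (b a))
  obtain ⟨γ, hγJ, hγb⟩ := (SiegelShimuraSet.mk_eq_mk_iff δ (principalLevelSubgroup δ N) _ _ _ _).1 hq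
  -- `γ⁻¹ J(v₀) γ = J(W₀) ∈ X⁺`
  set M : ↥(gspReal δ) := (gspRationalToReal δ γ)⁻¹ with hM
  have hMJ₀ : conjJ (M : GL (Fin g ⊕ Fin g) ℝ) (J v₀) = jOfSiegel δ W₀ := by
    have h := congrArg (fun J' : C0pm δ => (J' : Matrix (Fin g ⊕ Fin g) (Fin g ⊕ Fin g) ℝ)) hγJ
    simp only [coe_conjAct] at h
    rw [hM, Subgroup.coe_inv, ← h, ← conjJ_mul, inv_mul_cancel, conjJ_one]
  -- (2) `γ⁻¹` has negative multiplier, hence moves the whole cone family into `X⁺`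
  have hMC0 : ∀ v : Fin 2 → ℂ, v ∈ negCone (Jstar.map τ) → conjJ (M : GL (Fin g ⊕ Fin g) ℝ) (J v) ∈ C0 δ := by
    obtain ⟨ν, hν⟩ := exists_isMultiplier_realTypeForm M.2
    rcases lt_or_gt_of_ne (Units.ne_zero ν) with hneg | hpos
    · intro v hv
      have h := neg_conjJ_mem_C0_of_neg hν hneg (hJneg v hv)
      rwa [conjJ_neg, neg_neg] at h
    · exfalso
      have h := conjJ_mem_C0_of_pos hν hpos (hJneg v₀ hv₀)
      rw [conjJ_neg, hMJ₀] at h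
      exact neg_not_mem_C0_of_mem_C0 hg (jOfSiegel_mem_C0 hδ hW₀) h
  -- (3) the chart for `γ⁻¹`
  obtain ⟨Z, hZd, hZv⟩ := hZ (M : GL (Fin g ⊕ Fin g) ℝ) M.2 hMC0
  refine ⟨c, Z, hZd, fun v hv => ⟨(hZv v hv).1, ?_⟩⟩
  -- (4) the point identity `[J v, b a] = [J(Z v), rep c]`
  refine (SiegelShimuraSet.mk_eq_mk_iff δ (principalLevelSubgroup δ N) _ _ _ _).2 ⟨γ, Subtype.ext ?_, hγb⟩
  rw [coe_conjAct]
  change conjJ _ (jOfSiegel δ (Z v)) = J v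
  rw [← (hZv v hv).2, hM, Subgroup.coe_inv, ← conjJ_mul, mul_inv_cancel, conjJ_one]

end Slice

/-! ### §3. The moduli point map over abstract uniformised pieces (the `AuxChartGS` fields `f piece Z Z_hol Z_mem f_mk` by value) -/

section Moduli

/-- **THE SIEGEL MODULI POINT MAP OF THE UNITARY SHIMURA CURVE ALONG A HODGE-EMBEDDING DATUM** ([Deligne1979ShimuraVarieties] Prop. 2.3.10,
[Milne2005ShimuraVarieties] Lemma 5.13 + Thm. 5.16 + Thm. 5.17, read through the abstract uniformised pieces of [MumfordFogartyKirwan1994] App. 7A ∕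
★ (U)).  Under the datum `(J, b, bq)` (`hJ hJneg hJsmul hb hJrat`), a source level `K ≤ b⁻¹(K_δ(N))`, E2's period chart `hZ`, and ABSTRACT (U1)+(U2+)
data — a `ℂ`-scheme `Mc` which is the coproduct of pieces `Sc c`, `c ∈ (ℤ/N)ˣ` (colimit cofan `ιc`), uniformised through their complex points by
maps `unif c : 𝔥_g → (Sc c)(ℂ)` ONTO with the `Γ_δ(N)` moduli relation as fibres (`N ≥ 3`, `0 < g`, `δ` a polarisation type) — there are:
a point map `f : Sh_K(U(J⋆), 𝔻)(ℂ) → Mc(ℂ)`, a piece function `piece`, a PERIOD FUNCTION `Z a` per adelic representative, `ẑ`-units `u_c` of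
residue `c` with integral diagonal representatives `rep c = diag(1_g, u_c·1_g) ∈ K_δ(1)` of multiplier `u_c` (the five (U3) premisses of ★
`siegelModuli_complexUniformisation` verbatim), and a bijection `pts : Mc(ℂ) ≃ Sh_{K_δ(N)}(GSp_δ, S^±)(ℂ)`, such that: `Z a` is entrywise
holomorphic and `𝔥_g`-valued on the negative cone; **`f [v, aK] = (ιc (piece a))(ℂ)(unif (piece a) (Z a v))`**; `pts (f [v, aK]) = [J(v), b(a)]`;
`[J(v), b(a)] = [J(Z a v), rep (piece a)]`; and `pts ((ιc c)(ℂ)(unif c W)) = [J(W), rep c]` for every `W ∈ 𝔥_g`.  Assembly: §1 (the class map),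
§2 (slice charts, chosen once per `a`), ★ `exists_sigma_equiv_siegelShimuraSet_of_unif` (the principal dissection `(Σ c, (Sc c)(ℂ)) ≃ Sh_{K_δ(N)}(ℂ)`)
and ★ `Motives.exists_sigmaHomeomorph_of_isColimit_cofan` (`Mc(ℂ) ≃ Σ c, (Sc c)(ℂ)`).
[cite: Deligne1979ShimuraVarieties, Prop. 2.3.10] [cite: Milne2005ShimuraVarieties, Lemma 5.13 p. 57, Thm. 5.16, Thm. 5.17 p. 59, Thm. 6.11 p. 74]
[cite: Deligne1971TravauxShimura, Prop. 1.15 p. 132 and Exemple 4.16 p. 150] [cite: RapoportSmithlingZhang2020Diagonal, Prop. 3.7 (proof) pp. 13–14] -/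
theorem exists_moduliPointMapGS (hg : 0 < g) (hδ : IsPolarizationType δ) (hN : 3 ≤ N)
    (hJneg : ∀ v : Fin 2 → ℂ, v ∈ negCone (Jstar.map τ) → -J v ∈ C0 δ)
    (hJsmul : ∀ c : ℂ, c ≠ 0 → ∀ v : Fin 2 → ℂ, v ∈ negCone (Jstar.map τ) → J (c • v) = J v)
    (hb : ∀ γ : ↥(rational (↥(maximalRealSubfield L)) L (IsCMField.complexConj L) 2 Jstar),
      b (rationalToFinAdelic (↥(maximalRealSubfield L)) L (IsCMField.complexConj L) 2 Jstar γ) = gspRationalToFinAdelic δ (bq γ))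
    (hJrat : ∀ (γ : ↥(rational (↥(maximalRealSubfield L)) L (IsCMField.complexConj L) 2 Jstar)) (v : Fin 2 → ℂ),
      v ∈ negCone (Jstar.map τ) →
        J (((ratToGLℂ L Jstar τ γ : GL (Fin 2) ℂ) : Matrix (Fin 2) (Fin 2) ℂ) *ᵥ v) =
          conjJ ((gspRationalToReal δ (bq γ) : ↥(gspReal δ)) : GL (Fin g ⊕ Fin g) ℝ) (J v))
    (K : Subgroup ↥(finAdelic (↥(maximalRealSubfield L)) L (IsCMField.complexConj L) 2 Jstar))
    (hle : K ≤ (principalLevelSubgroup δ N).comap b)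
    (hZ : ∀ γ : GL (Fin g ⊕ Fin g) ℝ, γ ∈ gspReal δ → (∀ v : Fin 2 → ℂ, v ∈ negCone (Jstar.map τ) → conjJ γ (J v) ∈ C0 δ) →
      ∃ Z : (Fin 2 → ℂ) → Matrix (Fin g) (Fin g) ℂ,
        (∀ i j : Fin g, DifferentiableOn ℂ (fun v => Z v i j) (negCone (Jstar.map τ))) ∧
          ∀ v : Fin 2 → ℂ, v ∈ negCone (Jstar.map τ) → Z v ∈ siegelUpperHalfSpace g ∧ conjJ γ (J v) = jOfSiegel δ (Z v))
    {Mc : SchemeOver ℂ} {Sc : (ZMod N)ˣ → SchemeOver ℂ} {ιc : ∀ c, Sc c ⟶ Mc} (hc : IsColimit (Cofan.mk Mc ιc))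
    (unif : ∀ c : (ZMod N)ˣ, Matrix (Fin g) (Fin g) ℂ → ComplexPoints (Sc c))
    (hsurj : ∀ c, Set.SurjOn (unif c) (siegelUpperHalfSpace g) Set.univ)
    (hiff : ∀ c, ∀ W ∈ siegelUpperHalfSpace g, ∀ W' ∈ siegelUpperHalfSpace g,
      unif c W = unif c W' ↔ ∃ M ∈ siegelLevelGroup δ N, ∃ C : (Fin g → ℂ) ≃ₗ[ℂ] (Fin g → ℂ),
        ∀ x : Fin g ⊕ Fin g → ℝ, C (siegelPeriodMap δ W x) = siegelPeriodMap δ W' (intAct M x)) :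
    ∃ (f : ShimuraSetGS L Jstar τ K → ComplexPoints Mc)
      (piece : ↥(finAdelic (↥(maximalRealSubfield L)) L (IsCMField.complexConj L) 2 Jstar) → (ZMod N)ˣ)
      (Z : ↥(finAdelic (↥(maximalRealSubfield L)) L (IsCMField.complexConj L) 2 Jstar) → (Fin 2 → ℂ) → Matrix (Fin g) (Fin g) ℂ)
      (u : (ZMod N)ˣ → finAdeleQˣ) (rep : (ZMod N)ˣ → ↥(gspFinAdelic δ))
      (pts : ComplexPoints Mc ≃ SiegelShimuraSet δ (principalLevelSubgroup δ N)),
      (∀ c, (∀ w, Valued.v ((u c : finAdeleQ) w) = 1) ∧ (u c : finAdeleQ) - ((c : ZMod N).val : ℕ) ∈ levelIdeal N ∧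
        rep c ∈ principalLevelSubgroup δ 1 ∧
          IsMultiplier (typeFormOver δ finAdeleQ) (rep c : GL (Fin g ⊕ Fin g) finAdeleQ) (u c) ∧
            ((rep c : GL (Fin g ⊕ Fin g) finAdeleQ) : Matrix (Fin g ⊕ Fin g) (Fin g ⊕ Fin g) finAdeleQ) =
              Matrix.fromBlocks 1 0 0 ((u c : finAdeleQ) • (1 : Matrix (Fin g) (Fin g) finAdeleQ))) ∧
      (∀ a (i j : Fin g), DifferentiableOn ℂ (fun v => Z a v i j) (negCone (Jstar.map τ))) ∧
      (∀ a (v : Fin 2 → ℂ), v ∈ negCone (Jstar.map τ) → Z a v ∈ siegelUpperHalfSpace g) ∧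
      (∀ (v : Fin 2 → ℂ) (hv : v ∈ negCone (Jstar.map τ)) a,
        f (ShimuraSetGS.mk L Jstar τ K v hv a) = AlgPoints.map (ιc (piece a)) (unif (piece a) (Z a v))) ∧
      (∀ (v : Fin 2 → ℂ) (hv : v ∈ negCone (Jstar.map τ)) a,
        pts (f (ShimuraSetGS.mk L Jstar τ K v hv a)) = SiegelShimuraSet.mk δ (principalLevelSubgroup δ N) ⟨J v, hJ v hv⟩ (b a)) ∧
      (∀ (v : Fin 2 → ℂ) (hv : v ∈ negCone (Jstar.map τ)) a, ∃ hZv : Z a v ∈ siegelUpperHalfSpace g,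
        SiegelShimuraSet.mk δ (principalLevelSubgroup δ N) ⟨J v, hJ v hv⟩ (b a) =
          SiegelShimuraSet.mk δ (principalLevelSubgroup δ N)
            ⟨jOfSiegel δ (Z a v), C0_subset_C0pm δ (jOfSiegel_mem_C0 hδ.1 hZv)⟩ (rep (piece a))) ∧
      ∀ (c : (ZMod N)ˣ) (W : Matrix (Fin g) (Fin g) ℂ) (hW : W ∈ siegelUpperHalfSpace g),
        pts (AlgPoints.map (ιc c) (unif c W)) =
          SiegelShimuraSet.mk δ (principalLevelSubgroup δ N) ⟨jOfSiegel δ W, C0_subset_C0pm δ (jOfSiegel_mem_C0 hδ.1 hW)⟩ (rep c) := by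
  classical
  -- the principal dissection over the abstract pieces and the complex points of the coproduct
  obtain ⟨u, rep, e, hrep, he⟩ := exists_sigma_equiv_siegelShimuraSet_of_unif hδ hg hN unif hsurj hiff
  obtain ⟨Φ, hΦ⟩ := Motives.exists_sigmaHomeomorph_of_isColimit_cofan ℂ hc
  set pts : ComplexPoints Mc ≃ SiegelShimuraSet δ (principalLevelSubgroup δ N) := Φ.toEquiv.symm.trans e with hpts
  have hval : ∀ (c : (ZMod N)ˣ) (W : Matrix (Fin g) (Fin g) ℂ) (hW : W ∈ siegelUpperHalfSpace g),
      pts (AlgPoints.map (ιc c) (unif c W)) =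
        SiegelShimuraSet.mk δ (principalLevelSubgroup δ N) ⟨jOfSiegel δ W, C0_subset_C0pm δ (jOfSiegel_mem_C0 hδ.1 hW)⟩ (rep c) := by
    intro c W hW
    rw [hpts, Equiv.trans_apply, ← hΦ c (unif c W)]
    have h1 : Φ.toEquiv.symm (Φ ⟨c, unif c W⟩) = ⟨c, unif c W⟩ := Φ.toEquiv.symm_apply_apply _
    rw [h1]
    exact he c ⟨W, hW⟩
  -- every Siegel class is a moduli class `[J(W), rep c]`
  have hrep' : ∀ x : SiegelShimuraSet δ (principalLevelSubgroup δ N), ∃ (c : (ZMod N)ˣ) (W : Matrix (Fin g) (Fin g) ℂ)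
      (hW : W ∈ siegelUpperHalfSpace g),
      x = SiegelShimuraSet.mk δ (principalLevelSubgroup δ N) ⟨jOfSiegel δ W, C0_subset_C0pm δ (jOfSiegel_mem_C0 hδ.1 hW)⟩ (rep c) := by
    intro x
    obtain ⟨⟨c, P⟩, hcP⟩ := e.surjective x
    obtain ⟨W, hW, hWP⟩ := hsurj c (Set.mem_univ P)
    refine ⟨c, W, hW, ?_⟩
    rw [← hcP, ← hWP]
    exact he c ⟨W, hW⟩
  -- one slice chart per adelic representative (a choice)
  have hslice := fun a => exists_sliceChart J hJ b hg hδ.1 hJneg hZ rep 1 hrep' a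
  choose piece Z hZd hZpt using hslice
  -- the class map of §1, pulled back through `pts`
  obtain ⟨φ, hφ⟩ := exists_siegelPointMapGS J hJ b bq hJsmul hb hJrat K hle
  refine ⟨fun x => pts.symm (φ x), piece, Z, u, rep, pts, hrep, hZd, fun a v hv => (hZpt a v hv).1, fun v hv a => ?_,
    fun v hv a => by rw [Equiv.apply_symm_apply, hφ], fun v hv a => hZpt a v hv, hval⟩
  -- `f_mk`: `pts⁻¹ [J v, b a] = pts⁻¹ [J(Z a v), rep (piece a)] = (ιc (piece a))(ℂ)(unif (piece a) (Z a v))`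
  obtain ⟨hZv, hmk⟩ := hZpt a v hv
  rw [Equiv.symm_apply_eq, hφ, hmk, hval (piece a) (Z a v) hZv]

end Moduli

end UnitaryCurve

end Literature.AlgebraicGeometry.ShimuraVarieties

end
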